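import Mathlib.Analysis.Matrix.Order
import Mathlib.Analysis.Normed.Module.FiniteDimension
import Mathlib.Topology.Instances.Matrix
import Literature.MathematicalPhysics.QuantumLattice.SectorSpectrum
import HarnessLib

/-!
# FunctionFieldCertificate / support `CertificateCompleteness` (stmt-HubbardSuperconductivity-7334) —
# core linear algebra

Helper file (`--supports stmt-HubbardSuperconductivity-7334`) for
`Summit.HubbardSuperconductivity.HubbardSuperconductivity.Theses.FunctionFieldCertificate.CertificateCompleteness`;
the route statement itself is closed in `FunctionFieldCertificateCertificateCompleteness.lean`, which
instantiates `exists_certificate_core` below on Lieb's `(n, n)` block of Fock space.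

## The certificate (finite-dimensional linear algebra)

Setting: a finite index type `ι`, the coordinate subspace `K = {v | v i = 0 unless p i}` with its
diagonal `0/1` projection `P = Matrix.diagonal fun i => if p i then 1 else 0` (no definition is made), a
Hermitian `H` leaving `K` invariant, a real `E` bounding the Rayleigh quotient of `H` on `K` from below
(so `E = min spec H|_K` when attained), a unit eigenvector `u` with `H u = E u`, and a Hermitian `M` with
`Re⟨v, Mv⟩ > 0` at every unit `v ∈ K` with `H v = E v`.

* KKT block. `Q_j := √c · |u⟩⟨e_j|` over the standard basis `e_j`: because `H u = E u` and `‖u‖ = 1`,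
  `Σ_j Q_j†(H Q_j - Q_j H) = c (E·1 - H)` EXACTLY (`sum_conjTranspose_mul_commutator_rankOne`); each
  `Q_j` maps everything into `ℂu`.
* SOS block. For `c ≥ 0` large the form of `B_c := M + c (H - E)` is `≥ 0` on `K`: on the compact unit
  sphere of `K` (`isCompact_unitSphere_coord`), `g = Re⟨·,(H - E)·⟩ ≥ 0`, and where `g = 0` the vector is
  an eigenvector `H v = E v` (a PSD form vanishes only on its kernel, `mulVec_eq_zero_of_form_eq_zero`), so
  `f = Re⟨·,M·⟩ > 0` there; the compactness lemma `exists_nonneg_add_mul_nonneg` yields `f + c g ≥ 0`,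
  homogeneity extends it to `K`. Then `S := P B_c P` is positive semidefinite (`posSemidef_compression`),
  hence `S = O†O` (`CStarAlgebra.nonneg_iff_eq_star_mul_self` in the `MatrixOrder` C⋆-order).
* The sector term `T := M - S - Σ_j Q_j†[H, Q_j]` has zero expectation on `K`
  (`⟨v, Sv⟩ = ⟨v, B_c v⟩` for `v ∈ K`), and `M = O†O + Σ_j Q_j†(H Q_j - Q_j H) + T` is literal.

All statements are folklore finite-dimensional linear algebra (Tasaki, *Physics and Mathematics of
Quantum Many-Body Systems* (2020), §2.1–2.2 and App. A.2 for the variational facts). No definition is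
introduced.
-/

noncomputable section

-- the problem namespace `HubbardSuperconductivity.HubbardSuperconductivity` repeats a component by design
set_option linter.dupNamespace false

namespace Summit.HubbardSuperconductivity.HubbardSuperconductivity.Theorems.FunctionFieldCertificate

open Matrix
open scoped Matrix ComplexOrder MatrixOrder

/-! ### A compactness lemma and coordinate compressions -/

/-- Finite-dimensional "S-lemma" by compactness: on a compact set `X`, if `g ≥ 0` on `X` and `f > 0`
wherever `g = 0`, then `f + c g ≥ 0` on `X` for some `c ≥ 0` (minimise `g` on the compact set
`X ∩ {f ≤ 0}`). [folklore] -/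
theorem exists_nonneg_add_mul_nonneg {E : Type*} [TopologicalSpace E] {X : Set E}
    (hX : IsCompact X) {f g : E → ℝ} (hf : Continuous f) (hg : Continuous g)
    (hg0 : ∀ x ∈ X, 0 ≤ g x) (hfg : ∀ x ∈ X, g x = 0 → 0 < f x) :
    ∃ c : ℝ, 0 ≤ c ∧ ∀ x ∈ X, 0 ≤ f x + c * g x := by
  set X' : Set E := X ∩ f ⁻¹' (Set.Iic 0) with hX'
  have hX'c : IsCompact X' := hX.inter_right (isClosed_Iic.preimage hf)
  by_cases hne : X'.Nonempty
  · obtain ⟨x₀, hx₀, hmin_g⟩ := hX'c.exists_isMinOn hne hg.continuousOn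
    obtain ⟨x₁, hx₁, hmin_f⟩ := hX'c.exists_isMinOn hne hf.continuousOn
    have hf0 : f x₀ ≤ 0 := hx₀.2
    have hf1 : f x₁ ≤ 0 := hx₁.2
    have hg_pos : 0 < g x₀ := by
      rcases (hg0 x₀ hx₀.1).lt_or_eq with h | h
      · exact h
      · exact absurd hf0 (not_le.mpr (hfg x₀ hx₀.1 h.symm))
    have hc : 0 ≤ -f x₁ / g x₀ := div_nonneg (neg_nonneg.mpr hf1) hg_pos.le
    refine ⟨-f x₁ / g x₀, hc, fun x hx => ?_⟩
    by_cases hfx : f x ≤ 0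
    · have hxX' : x ∈ X' := ⟨hx, hfx⟩
      have h1 : g x₀ ≤ g x := (isMinOn_iff.mp hmin_g) x hxX'
      have h2 : f x₁ ≤ f x := (isMinOn_iff.mp hmin_f) x hxX'
      have h3 : -f x₁ / g x₀ * g x₀ ≤ -f x₁ / g x₀ * g x := mul_le_mul_of_nonneg_left h1 hc
      have h4 : -f x₁ / g x₀ * g x₀ = -f x₁ := div_mul_cancel₀ _ hg_pos.ne'
      linarith
    · push Not at hfx
      have := mul_nonneg hc (hg0 x hx)
      linarith
  · refine ⟨0, le_rfl, fun x hx => ?_⟩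
    rw [zero_mul, add_zero]
    by_contra h
    exact hne ⟨x, hx, le_of_lt (not_le.mp h)⟩

/-! ### Compressions `P B P` by a Hermitian `P` -/

section Compression

variable {ι : Type*} [Fintype ι]

/-- The quadratic form of `P B P` (for Hermitian `P`) is the form of `B` at `P x`. [folklore] -/
theorem star_dotProduct_compression_mulVec {P : Matrix ι ι ℂ} (hP : Pᴴ = P) (B : Matrix ι ι ℂ)
    (x : ι → ℂ) : star x ⬝ᵥ (P * B * P) *ᵥ x = star (P *ᵥ x) ⬝ᵥ B *ᵥ (P *ᵥ x) := by
  rw [← mulVec_mulVec, ← mulVec_mulVec, dotProduct_mulVec, star_mulVec, hP]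

/-- If `B` is Hermitian with nonnegative form on a set `S` containing the range of a Hermitian `P`,
then the compression `P B P` is positive semidefinite. [folklore] -/
theorem posSemidef_compression {P B : Matrix ι ι ℂ} (hP : Pᴴ = P) (hB : B.IsHermitian)
    (S : Set (ι → ℂ)) (hrange : ∀ x, P *ᵥ x ∈ S) (h0 : ∀ v ∈ S, 0 ≤ (star v ⬝ᵥ B *ᵥ v).re) :
    (P * B * P).PosSemidef := by
  refine PosSemidef.of_dotProduct_mulVec_nonneg ?_ fun x => ?_
  · have h1 : P * B * P = Pᴴ * B * P := by rw [hP]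
    rw [h1]
    exact isHermitian_conjTranspose_mul_mul _ hB
  · rw [star_dotProduct_compression_mulVec hP]
    have him := hB.im_star_dotProduct_mulVec_self (P *ᵥ x)
    rw [RCLike.im_to_complex] at him
    exact Complex.nonneg_iff.mpr ⟨h0 _ (hrange x), him.symm⟩

/-- In the situation of `posSemidef_compression`: a vector `v = P v` with `B v = P (B v)` on which the
form of `B` vanishes lies in the kernel of `B` (a positive semidefinite form vanishes only on its
kernel, `Matrix.PosSemidef.dotProduct_mulVec_zero_iff`, applied to `P B P`). This is the variational
characterisation of sector ground states. [folklore] -/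
theorem mulVec_eq_zero_of_form_eq_zero {P B : Matrix ι ι ℂ} (hP : Pᴴ = P) (hB : B.IsHermitian)
    (S : Set (ι → ℂ)) (hrange : ∀ x, P *ᵥ x ∈ S) (h0 : ∀ v ∈ S, 0 ≤ (star v ⬝ᵥ B *ᵥ v).re)
    {v : ι → ℂ} (hv : P *ᵥ v = v) (hBv : P *ᵥ (B *ᵥ v) = B *ᵥ v)
    (hzero : star v ⬝ᵥ B *ᵥ v = 0) : B *ᵥ v = 0 := by
  have hpsd := posSemidef_compression hP hB S hrange h0
  have h1 : star v ⬝ᵥ (P * B * P) *ᵥ v = 0 := by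
    rw [star_dotProduct_compression_mulVec hP, hv, hzero]
  have h2 := (hpsd.dotProduct_mulVec_zero_iff v).mp h1
  rwa [← mulVec_mulVec, ← mulVec_mulVec, hv, hBv] at h2

end Compression

section Coord

variable {ι : Type*} [Fintype ι] [DecidableEq ι] (p : ι → Prop) [DecidablePred p]

omit [DecidableEq ι] [DecidablePred p] in
/-- The unit sphere (for `star v ⬝ᵥ v`) of a coordinate subspace of `ι → ℂ` is compact (closed, and
inside the sup-norm unit ball). [folklore] -/
theorem isCompact_unitSphere_coord :
    IsCompact {v : ι → ℂ | (∀ i, ¬ p i → v i = 0) ∧ star v ⬝ᵥ v = 1} := by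
  have hcont : Continuous fun v : ι → ℂ => star v ⬝ᵥ v :=
    continuous_star.dotProduct continuous_id
  refine Metric.isCompact_of_isClosed_isBounded ?_ ?_
  · have h1 : IsClosed {v : ι → ℂ | ∀ i, ¬ p i → v i = 0} := by
      have : {v : ι → ℂ | ∀ i, ¬ p i → v i = 0} = ⋂ i ∈ {i | ¬ p i}, {v : ι → ℂ | v i = 0} := by
        ext v; simp
      rw [this]
      exact isClosed_biInter fun i _ => isClosed_eq (continuous_apply i) continuous_const
    have h2 : IsClosed {v : ι → ℂ | star v ⬝ᵥ v = 1} := isClosed_eq hcont continuous_const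
    exact h1.inter h2
  · refine (Metric.isBounded_closedBall (x := (0 : ι → ℂ)) (r := 1)).subset ?_
    rintro v ⟨-, hv⟩
    rw [Metric.mem_closedBall, dist_zero_right, pi_norm_le_iff_of_nonneg zero_le_one]
    intro i
    have hsum : (star v ⬝ᵥ v).re = ∑ j, ‖v j‖ ^ 2 := by
      simp only [dotProduct, Pi.star_apply, Complex.re_sum]
      refine Finset.sum_congr rfl fun j _ => ?_
      rw [Complex.star_def, ← Complex.normSq_eq_conj_mul_self, Complex.ofReal_re,
        Complex.normSq_eq_norm_sq]
    have hle : ‖v i‖ ^ 2 ≤ ∑ j, ‖v j‖ ^ 2 :=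
      Finset.single_le_sum (f := fun j => ‖v j‖ ^ 2) (fun j _ => sq_nonneg _) (Finset.mem_univ i)
    rw [← hsum, hv, Complex.one_re] at hle
    exact (sq_le_one_iff₀ (norm_nonneg _)).mp hle

/-! ### The KKT block -/

omit [DecidablePred p] in
/-- **Rank-one KKT generators.** For an eigenvector `u` of `H` (`H u = E u`), the matrices
`Q_j = |u⟩⟨e_j|` over the standard basis satisfy `Σ_j Q_j† (H Q_j - Q_j H) = ‖u‖² (E·1 - H)`
exactly. [folklore] -/
theorem sum_conjTranspose_mul_commutator_rankOne
    (H : Matrix ι ι ℂ) (u : ι → ℂ) (E : ℂ) (hu : H *ᵥ u = E • u) :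
    ∑ j : ι, (vecMulVec u (Pi.single j 1))ᴴ *
        (H * vecMulVec u (Pi.single j 1) - vecMulVec u (Pi.single j 1) * H) =
      (star u ⬝ᵥ u) • (E • (1 : Matrix ι ι ℂ) - H) := by
  have hstar : ∀ j : ι, star (Pi.single j (1 : ℂ) : ι → ℂ) = Pi.single j 1 := by
    intro j
    ext i
    by_cases h : i = j
    · subst h; simp
    · simp [h]
  have hterm : ∀ j : ι, (vecMulVec u (Pi.single j 1))ᴴ *
      (H * vecMulVec u (Pi.single j 1) - vecMulVec u (Pi.single j 1) * H) =
      (star u ⬝ᵥ u) • (vecMulVec (Pi.single j (1 : ℂ)) (E • Pi.single j 1) -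
        vecMulVec (Pi.single j (1 : ℂ)) (Pi.single j 1 ᵥ* H)) := by
    intro j
    rw [conjTranspose_vecMulVec, hstar, mul_sub, mul_vecMulVec, hu, vecMulVec_mul u,
      vecMulVec_mul_vecMulVec, vecMulVec_mul_vecMulVec, dotProduct_smul, smul_eq_mul,
      smul_sub, ← vecMulVec_smul, ← vecMulVec_smul, smul_smul, mul_comm (star u ⬝ᵥ u) E]
  simp_rw [hterm]
  rw [← Finset.smul_sum, Finset.sum_sub_distrib]
  congr 1
  have h1 : ∑ j : ι, vecMulVec (Pi.single j (1 : ℂ)) (Pi.single j 1 ᵥ* H) = H := by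
    ext a b
    simp [Matrix.sum_apply, vecMulVec_apply, Pi.single_apply, single_vecMul]
  have h2 : ∑ j : ι, vecMulVec (Pi.single j (1 : ℂ)) (E • Pi.single j 1) = E • (1 : Matrix ι ι ℂ) := by
    ext a b
    simp [Matrix.sum_apply, vecMulVec_apply, Pi.single_apply, Matrix.one_apply]
  rw [h1, h2]

/-! ### The core lemma -/

/-- The quadratic form of `c • (H - E·1)`, expanded. [folklore] -/
theorem form_smul_sub (H : Matrix ι ι ℂ) (c E : ℂ) (v : ι → ℂ) :
    star v ⬝ᵥ (c • (H - E • (1 : Matrix ι ι ℂ))) *ᵥ v =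
      c * (star v ⬝ᵥ H *ᵥ v - E * (star v ⬝ᵥ v)) := by
  rw [smul_mulVec, sub_mulVec, smul_mulVec, one_mulVec, dotProduct_smul, dotProduct_sub,
    dotProduct_smul, smul_eq_mul, smul_eq_mul]

/-- **Core completeness lemma** (abstract form of `CertificateCompleteness` at one `L`). Let `H` be
Hermitian and leave the coordinate subspace `K = {v | v i = 0 unless p i}` invariant, let `E` bound the
Rayleigh quotient of `H` on `K` from below, let `u ∈ K`-or-not be a unit eigenvector `H u = E u`, and
let `M` be Hermitian with `Re⟨v, Mv⟩ > 0` at every unit `v ∈ K` with `H v = E v`. Then for some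
`c ≥ 0`, some `O` and some `T` with zero expectation on `K`,
`M = O†O + Σ_j Q_j†(H Q_j - Q_j H) + T` with `Q_j = |√c·u⟩⟨e_j|`. Proof in the module docstring.
[folklore] -/
theorem exists_certificate_core (H M : Matrix ι ι ℂ) (hH : H.IsHermitian) (hM : M.IsHermitian)
    (hinv : ∀ v : ι → ℂ, (∀ i, ¬ p i → v i = 0) → ∀ i, ¬ p i → (H *ᵥ v) i = 0)
    (E : ℝ)
    (hE : ∀ v : ι → ℂ, (∀ i, ¬ p i → v i = 0) → E * (star v ⬝ᵥ v).re ≤ (star v ⬝ᵥ H *ᵥ v).re)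
    (hpos : ∀ v : ι → ℂ, (∀ i, ¬ p i → v i = 0) → star v ⬝ᵥ v = 1 → H *ᵥ v = (E : ℂ) • v →
      0 < (star v ⬝ᵥ M *ᵥ v).re)
    (u : ι → ℂ) (hu1 : star u ⬝ᵥ u = 1) (hHu : H *ᵥ u = (E : ℂ) • u) :
    ∃ (O T : Matrix ι ι ℂ) (c : ℝ), 0 ≤ c ∧
      (∀ v : ι → ℂ, (∀ i, ¬ p i → v i = 0) → star v ⬝ᵥ T *ᵥ v = 0) ∧
      M = Oᴴ * O + ∑ j : ι, (vecMulVec (((Real.sqrt c : ℝ) : ℂ) • u) (Pi.single j 1))ᴴ *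
            (H * vecMulVec (((Real.sqrt c : ℝ) : ℂ) • u) (Pi.single j 1) -
              vecMulVec (((Real.sqrt c : ℝ) : ℂ) • u) (Pi.single j 1) * H) + T := by
  -- the diagonal `0/1` projection `P` onto the sector `K = {v | v i = 0 unless p i}`
  set P : Matrix ι ι ℂ := diagonal fun i => ite (p i) 1 0 with hP_def
  have hPapply : ∀ (x : ι → ℂ) (i : ι), (P *ᵥ x) i = ite (p i) (x i) 0 := by
    intro x i
    rw [hP_def, mulVec_diagonal]
    split_ifs <;> simp
  have hP : Pᴴ = P := by
    rw [hP_def, diagonal_conjTranspose]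
    congr 1
    funext i
    by_cases hi : p i <;> simp [hi]
  have hrange : ∀ x : ι → ℂ, P *ᵥ x ∈ {v : ι → ℂ | ∀ i, ¬ p i → v i = 0} := by
    intro x i hi
    rw [hPapply, if_neg hi]
  have hPid : ∀ v : ι → ℂ, (∀ i, ¬ p i → v i = 0) → P *ᵥ v = v := by
    intro v hv
    funext i
    rw [hPapply]
    split_ifs with hi
    · rfl
    · exact (hv i hi).symm
  -- the two quadratic forms
  set f : (ι → ℂ) → ℝ := fun v => (star v ⬝ᵥ M *ᵥ v).re with hf_def
  set g : (ι → ℂ) → ℝ := fun v => (star v ⬝ᵥ (H - (E : ℂ) • (1 : Matrix ι ι ℂ)) *ᵥ v).re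
    with hg_def
  have hE1 : ((E : ℂ) • (1 : Matrix ι ι ℂ)).IsHermitian := by
    rw [IsHermitian, conjTranspose_smul, conjTranspose_one, Complex.star_def, Complex.conj_ofReal]
  have hB : (H - (E : ℂ) • (1 : Matrix ι ι ℂ)).IsHermitian := hH.sub hE1
  have hformB : ∀ v : ι → ℂ, star v ⬝ᵥ (H - (E : ℂ) • (1 : Matrix ι ι ℂ)) *ᵥ v =
      star v ⬝ᵥ H *ᵥ v - (E : ℂ) * (star v ⬝ᵥ v) := by
    intro v
    have h := form_smul_sub H 1 (E : ℂ) v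
    rwa [one_smul, one_mul] at h
  have hg_eq : ∀ v, g v = (star v ⬝ᵥ H *ᵥ v).re - E * (star v ⬝ᵥ v).re := by
    intro v
    simp only [hg_def, hformB, Complex.sub_re, Complex.re_ofReal_mul]
  have hf_cont : Continuous f :=
    Complex.continuous_re.comp (continuous_star.dotProduct (continuous_const.matrix_mulVec continuous_id))
  have hg_cont : Continuous g :=
    Complex.continuous_re.comp (continuous_star.dotProduct (continuous_const.matrix_mulVec continuous_id))
  -- `g ≥ 0` on the sector (variational bound)
  have hg0 : ∀ v : ι → ℂ, (∀ i, ¬ p i → v i = 0) → 0 ≤ g v := by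
    intro v hv
    rw [hg_eq]
    linarith [hE v hv]
  -- `g = 0` at a unit vector of the sector forces a ground state, where `f > 0`
  have hfg : ∀ v ∈ {v : ι → ℂ | (∀ i, ¬ p i → v i = 0) ∧ star v ⬝ᵥ v = 1}, g v = 0 → 0 < f v := by
    rintro v ⟨hv, hv1⟩ hgv
    have hBv : ∀ i, ¬ p i → ((H - (E : ℂ) • (1 : Matrix ι ι ℂ)) *ᵥ v) i = 0 := by
      intro i hi
      rw [sub_mulVec, smul_mulVec, one_mulVec, Pi.sub_apply, Pi.smul_apply, hinv v hv i hi,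
        hv i hi, smul_zero, sub_zero]
    have hzero : star v ⬝ᵥ (H - (E : ℂ) • (1 : Matrix ι ι ℂ)) *ᵥ v = 0 := by
      apply Complex.ext
      · exact hgv
      · have him := hB.im_star_dotProduct_mulVec_self v
        rw [RCLike.im_to_complex] at him
        rw [him, Complex.zero_im]
    have hker := mulVec_eq_zero_of_form_eq_zero hP hB _ hrange (fun w hw => hg0 w hw) (hPid v hv)
      (hPid _ hBv) hzero
    rw [sub_mulVec, smul_mulVec, one_mulVec, sub_eq_zero] at hker
    exact hpos v hv hv1 hker
  -- compactness: `f + c g ≥ 0` on the unit sphere of the sector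
  obtain ⟨c, hc, hfc⟩ := exists_nonneg_add_mul_nonneg (isCompact_unitSphere_coord p) hf_cont
    hg_cont (fun v hv => hg0 v hv.1) hfg
  -- the shifted matrix `B_c = M + c (H - E)` and its form
  set Bc : Matrix ι ι ℂ := M + (c : ℂ) • (H - (E : ℂ) • (1 : Matrix ι ι ℂ)) with hBc_def
  have hBc : Bc.IsHermitian := by
    refine hM.add (hB.smul ?_)
    rw [isSelfAdjoint_iff, Complex.star_def, Complex.conj_ofReal]
  have hformBc : ∀ v : ι → ℂ, star v ⬝ᵥ Bc *ᵥ v =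
      star v ⬝ᵥ M *ᵥ v + (c : ℂ) * (star v ⬝ᵥ H *ᵥ v - (E : ℂ) * (star v ⬝ᵥ v)) := by
    intro v
    rw [hBc_def, add_mulVec, dotProduct_add, form_smul_sub]
  have hformBc_re : ∀ v : ι → ℂ, (star v ⬝ᵥ Bc *ᵥ v).re = f v + c * g v := by
    intro v
    rw [hformBc, hg_eq]
    simp only [hf_def, Complex.add_re, Complex.re_ofReal_mul, Complex.sub_re]
  -- `B_c ≥ 0` on the whole sector, by homogeneity
  have hBc0 : ∀ v : ι → ℂ, (∀ i, ¬ p i → v i = 0) → 0 ≤ (star v ⬝ᵥ Bc *ᵥ v).re := by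
    intro v hv
    by_cases hv0 : v = 0
    · rw [hv0, mulVec_zero, dotProduct_zero, Complex.zero_re]
    obtain ⟨c', hc'0, hc'1⟩ := Literature.MathematicalPhysics.QuantumLattice.exists_smul_unit hv0
    have hmem : (∀ i, ¬ p i → (c' • v) i = 0) := fun i hi => by
      rw [Pi.smul_apply, hv i hi, smul_zero]
    have h1 := hfc (c' • v) ⟨hmem, hc'1⟩
    rw [← hformBc_re, star_smul, mulVec_smul, smul_dotProduct, dotProduct_smul, smul_smul,
      Complex.star_def, ← Complex.normSq_eq_conj_mul_self, smul_eq_mul,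
      Complex.re_ofReal_mul] at h1
    exact (mul_nonneg_iff_of_pos_left (Complex.normSq_pos.mpr hc'0)).mp h1
  -- the SOS block
  have hS : (P * Bc * P).PosSemidef := posSemidef_compression hP hBc _ hrange hBc0
  obtain ⟨O, hO⟩ := CStarAlgebra.nonneg_iff_eq_star_mul_self.mp hS.nonneg
  rw [Matrix.star_eq_conjTranspose] at hO
  -- the KKT block
  have hHu' : H *ᵥ ((((Real.sqrt c : ℝ) : ℂ) • u)) = (E : ℂ) • ((((Real.sqrt c : ℝ) : ℂ) • u)) := by
    rw [mulVec_smul, hHu, smul_comm]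
  have hnorm : star ((((Real.sqrt c : ℝ) : ℂ) • u)) ⬝ᵥ ((((Real.sqrt c : ℝ) : ℂ) • u)) = (c : ℂ) := by
    rw [star_smul, smul_dotProduct, dotProduct_smul, hu1, Complex.star_def,
      Complex.conj_ofReal, smul_eq_mul, smul_eq_mul, mul_one, ← Complex.ofReal_mul,
      Real.mul_self_sqrt hc]
  have hSum := sum_conjTranspose_mul_commutator_rankOne H _ (E : ℂ) hHu'
  rw [hnorm] at hSum
  refine ⟨O, M - P * Bc * P -
      ∑ j : ι, (vecMulVec ((((Real.sqrt c : ℝ) : ℂ) • u)) (Pi.single j 1))ᴴ *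
        (H * vecMulVec ((((Real.sqrt c : ℝ) : ℂ) • u)) (Pi.single j 1) -
          vecMulVec ((((Real.sqrt c : ℝ) : ℂ) • u)) (Pi.single j 1) * H), c, hc, ?_, ?_⟩
  · intro v hv
    rw [hSum, sub_mulVec, sub_mulVec, dotProduct_sub, dotProduct_sub,
      star_dotProduct_compression_mulVec hP, hPid v hv, hformBc,
      ← neg_sub H, smul_neg, neg_mulVec, dotProduct_neg, form_smul_sub]
    ring
  · rw [← hO]
    abel

end Coord

end Summit.HubbardSuperconductivity.HubbardSuperconductivity.Theorems.FunctionFieldCertificate
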